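import Summits.QuantumAdvantage.QuantumAdvantage.Theses.SpinorFlattening
import Summits.QuantumAdvantage.QuantumAdvantage.Theorems.SpinorFlatteningNegApproxGaussRankSuperpolyMassBound
import Summits.QuantumAdvantage.QuantumAdvantage.Theorems.SpinorFlatteningNegApproxGaussRankSuperpolyFlatOrthoOfInvariant
import Summits.QuantumAdvantage.QuantumAdvantage.Theorems.SpinorFlatteningNegApproxGaussRankSuperpolyMagicInvariant
import Summits.QuantumAdvantage.QuantumAdvantage.Theorems.SpinorFlatteningNegApproxGaussRankSuperpolyCountGap
import Literature.Computability.QuantumComplexity.GaussianRank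

/-!
# Crux-triage r1 k=2 evidence for `FlatteningBoundRobust` (stmt-QuantumAdvantage-1246)

KERNEL-CHECKED STAFFING FACT (refuter-cruxtri-stmt-QuantumAdvantage-1246-r1-2-0, 2026-08-16):
after the landings on the sibling crux 1245's picked line `spectral-mass-flattening`
(`stub_massBound` p71968, `stub_filterCard` p74182, `stub_flatOrthoOfInvariant` p74600,
`stub_magicInvariant` p74598, `stub_countGap` p74656 — all imported below as THEOREMS),
the crux `SpinorFlattening.FlatteningBoundRobust` follows from the ONE remaining open stub
`stub_normalOrder` of that line and nothing else:

  `flatteningBoundRobust_of_normalOrder : NormalOrder → FlatteningBoundRobust`   (sorry-free)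

where `NormalOrder` is character-for-character the registered type of
`Theorems.SpinorFlattening.stub_normalOrder` (Cruxes/NegApproxGaussRankSuperpoly/Lines/spectral-mass-flattening.lean).
On the way: the SHARP form `sharp_of_normalOrder` (`C(t,K)8^K − r·D_K(4t) ≤ C(t,K)8^K·‖M^t − φ‖²`,
= the Transfer C⁺ of cards isometric-subflattening-bessel / mass-bound-corollary /
isometric-subflattening-deficit), obtained with only the LOWER count `C(t,K)8^K ≤ |𝔉_K|`
(landed `countGap_choose_mul_pow_le_card`) — no cardinality EQUALITY of the flat family is needed.
Credits: composition pattern = the 1245 skeleton's `deficiency_of_parts` /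
`NegApproxGaussRankSuperpoly_of_parts` (lead) and `Ideator1Sketch.flatteningBoundRobust_of_stubs`
(ideator 1); `choose_mul_pow_le` copied from crux workfile `Transfer.lean` (ideator 3).
This is item EVIDENCE (positive side), not a refuter landing.
-/

set_option linter.dupNamespace false

noncomputable section

namespace Summit.QuantumAdvantage.QuantumAdvantage.Cruxes.FlatteningBoundRobust.Triage2Corollary

open Matrix Finset
open Literature.Computability.QuantumComplexity Literature.Computability.Cryptography
open Summit.QuantumAdvantage.QuantumAdvantage.Theorems.SpinorFlattening
open Summit.QuantumAdvantage.QuantumAdvantage.Theses.SpinorFlattening (FlatteningBoundRobust)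

/-- VERBATIM the registered type of the open stub `stub_normalOrder` of line spectral-mass-flattening
(crux 1245): CAR normal ordering of one Gaussian state along some complement of its annihilators. -/
def NormalOrder : Prop :=
  ∀ (n K : ℕ) (g : QReg n → ℂ), IsGaussian g →
    ∃ u : Fin n → (Fin n × Bool → ℂ),
      ∀ l : List (Fin n × Bool), l.length = K →
        (l.map fun p => majorana n p.1 p.2).prod *ᵥ g ∈
          Submodule.span ℂ (Set.range fun I : {I : Finset (Fin n) // I.card ≤ K ∧ I.card % 2 = K % 2} =>
            ((I.1.sort (· ≤ ·)).map fun i => ∑ p : Fin n × Bool, u i p • majorana n p.1 p.2).prod *ᵥ g)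


/-! ### Local copy of the landed `stub_filterCard` (p74182; its module was not yet in the farm build when this
variant was checked) -/

theorem filterCard_mem_biUnion_iff' (n K : ℕ) (I : Finset (Fin n)) :
    I ∈ ((Finset.range (K + 1)).filter (fun j => j % 2 = K % 2)).biUnion
        (fun j => Finset.powersetCard j (Finset.univ : Finset (Fin n))) ↔
      I.card ≤ K ∧ I.card % 2 = K % 2 := by
  simp only [Finset.mem_biUnion, Finset.mem_filter, Finset.mem_range,
    Finset.mem_powersetCard_univ]
  constructor
  · rintro ⟨j, ⟨hj, hj2⟩, rfl⟩
    exact ⟨Nat.le_of_lt_succ hj, hj2⟩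
  · rintro ⟨h1, h2⟩
    exact ⟨I.card, ⟨Nat.lt_succ_of_le h1, h2⟩, rfl⟩

theorem filterCard_pairwiseDisjoint' (n K : ℕ) :
    (((Finset.range (K + 1)).filter (fun j => j % 2 = K % 2) : Finset ℕ) : Set ℕ).PairwiseDisjoint
      (fun j => Finset.powersetCard j (Finset.univ : Finset (Fin n))) :=
  fun _ _ _ _ hij => Finset.pairwise_disjoint_powersetCard _ hij

theorem filterCard' :
    ∀ n K : ℕ, Fintype.card {I : Finset (Fin n) // I.card ≤ K ∧ I.card % 2 = K % 2} =
      flatteningDeficiency K n := by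
  intro n K
  rw [Fintype.card_of_subtype _ (filterCard_mem_biUnion_iff' n K),
    Finset.card_biUnion (filterCard_pairwiseDisjoint' n K), flatteningDeficiency_eq]
  refine Finset.sum_congr rfl fun j _ => ?_
  rw [Finset.card_powersetCard, Finset.card_univ, Fintype.card_fin]

/-- Pascal iterated: `C(n, K+1) + m·C(n, K) ≤ C(n+m, K+1)` (copied from crux workfile Transfer.lean). -/
theorem choose_succ_add_mul_le (n K : ℕ) : ∀ m : ℕ,
    n.choose (K + 1) + m * n.choose K ≤ (n + m).choose (K + 1)
  | 0 => by simp
  | m + 1 => by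
    have ih := choose_succ_add_mul_le n K m
    have hmono : n.choose K ≤ (n + m).choose K := Nat.choose_le_choose K (Nat.le_add_right n m)
    have hP : (n + (m + 1)).choose (K + 1) = (n + m).choose K + (n + m).choose (K + 1) := by
      rw [← Nat.add_assoc, Nat.choose_succ_succ']
    rw [hP]
    nlinarith [ih, hmono]

/-- `C(t,K)·8^K ≤ C(8t,K)` (copied from crux workfile Transfer.lean). -/
theorem choose_mul_pow_le : ∀ t K : ℕ, t.choose K * 8 ^ K ≤ (t * 8).choose K
  | 0, 0 => by simp
  | 0, K + 1 => by simp
  | t + 1, 0 => by simp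
  | t + 1, K + 1 => by
    have ih0 := choose_mul_pow_le t K
    have ih1 := choose_mul_pow_le t (K + 1)
    have hA := choose_succ_add_mul_le (t * 8) K 8
    have hmul : (t + 1) * 8 = t * 8 + 8 := by ring
    have ih1' : t.choose (K + 1) * (8 ^ K * 8) ≤ (t * 8).choose (K + 1) := by
      rw [← pow_succ]; exact ih1
    rw [hmul, Nat.choose_succ_succ', pow_succ]
    have hsplit : (t.choose K + t.choose (K + 1)) * (8 ^ K * 8) =
        8 * (t.choose K * 8 ^ K) + t.choose (K + 1) * (8 ^ K * 8) := by ring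
    rw [hsplit]
    calc 8 * (t.choose K * 8 ^ K) + t.choose (K + 1) * (8 ^ K * 8)
        ≤ 8 * (t * 8).choose K + (t * 8).choose (K + 1) :=
          Nat.add_le_add (Nat.mul_le_mul_left 8 ih0) ih1'
      _ ≤ (t * 8 + 8).choose (K + 1) := by linarith [hA]

/-- DEFICIENCY for `r`-term Gaussian combinations from `NormalOrder` + the LANDED `stub_filterCard`
(the 1245 skeleton's `deficiency_of_parts`, with its second hypothesis discharged). -/
theorem deficiency_of_normalOrder (hN : NormalOrder) :
    ∀ (n K r : ℕ) (a : Fin r → ℂ) (g : Fin r → QReg n → ℂ), (∀ i, IsGaussian (g i)) →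
      ∃ W : Submodule ℂ (QReg n → ℂ), Module.finrank ℂ W ≤ r * flatteningDeficiency K n ∧
        ∀ l : List (Fin n × Bool), l.length = K →
          (l.map fun p => majorana n p.1 p.2).prod *ᵥ (∑ i, a i • g i) ∈ W := by
  intro n K r a g hg
  classical
  choose u hu using fun i => hN n K (g i) (hg i)
  let ι : Type := {I : Finset (Fin n) // I.card ≤ K ∧ I.card % 2 = K % 2}
  let f : Fin r → ι → (QReg n → ℂ) := fun i I =>
    ((I.1.sort (· ≤ ·)).map fun j => ∑ p : Fin n × Bool, u i j p • majorana n p.1 p.2).prod *ᵥ g i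
  let F : Fin r × ι → (QReg n → ℂ) := fun x => f x.1 x.2
  refine ⟨Submodule.span ℂ (Set.range F), ?_, ?_⟩
  · calc Module.finrank ℂ (Submodule.span ℂ (Set.range F)) ≤ Fintype.card (Fin r × ι) :=
          finrank_range_le_card F
      _ = r * flatteningDeficiency K n := by
          rw [Fintype.card_prod, Fintype.card_fin, filterCard']
  · intro l hl
    rw [Matrix.mulVec_sum]
    refine Submodule.sum_mem _ fun i _ => ?_
    rw [Matrix.mulVec_smul]
    refine Submodule.smul_mem _ _ ?_
    have hsub : Submodule.span ℂ (Set.range (f i)) ≤ Submodule.span ℂ (Set.range F) :=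
      Submodule.span_mono (by
        rintro _ ⟨I, rfl⟩
        exact ⟨(i, I), rfl⟩)
    exact hsub (hu i l hl)

/-- FULLNESS, now a THEOREM: the former `stub_flatOrthonormal`, from the LANDED
`stub_flatOrthoOfInvariant` (p74600) and `stub_magicInvariant` (p74598). -/
theorem flatOrthonormal_landed :
    ∀ (t : ℕ) (mono : (Fin t → Option (Fin 4 × Bool)) → Matrix (QReg (t * 4)) (QReg (t * 4)) ℂ),
      (∀ s, mono s = ((List.finRange t).filterMap fun b =>
          (s b).map fun q => majorana (t * 4) (finProdFinEquiv (b, q.1)) q.2).prod) →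
      (∀ s, star (mono s *ᵥ magicMPow t) ⬝ᵥ (mono s *ᵥ magicMPow t) = 1) ∧
        ∀ s s', s ≠ s' → star (mono s *ᵥ magicMPow t) ⬝ᵥ (mono s' *ᵥ magicMPow t) = 0 := by
  intro t mono hmono
  obtain ⟨hX, hZ, h1⟩ := stub_magicInvariant t
  exact stub_flatOrthoOfInvariant t mono hmono (magicMPow t) hX hZ h1

/-- The labels excited by a block pattern have as many entries as there are excited blocks
(verbatim from the 1245 skeleton). -/
theorem length_filterMap_labels (t : ℕ) (s : Fin t → Option (Fin 4 × Bool)) :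
    ((List.finRange t).filterMap fun b =>
        (s b).map fun q => ((finProdFinEquiv (b, q.1) : Fin (t * 4)), q.2)).length =
      (univ.filter fun b => (s b).isSome).card := by
  classical
  have key : ∀ L : List (Fin t), (L.filterMap fun b =>
      (s b).map fun q => ((finProdFinEquiv (b, q.1) : Fin (t * 4)), q.2)).length =
        (L.filter fun b => (s b).isSome).length := by
    intro L
    induction L with
    | nil => simp
    | cons b L ih =>
      cases hb : s b with
      | none => simp [hb, ih]
      | some q => simp [hb, ih]
  rw [key, ← List.toFinset_card_of_nodup ((List.nodup_finRange t).filter _)]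
  congr 1
  ext b
  simp

theorem normSq_nonneg' {n : ℕ} (ψ : QReg n → ℂ) : 0 ≤ normSq ψ := by
  unfold normSq
  positivity

/-- **The SHARP robust flattening bound from `NormalOrder` alone** (everything else landed):
`C(t,K)·8^K − r·D_K(4t) ≤ C(t,K)·8^K · ‖M^{⊗t} − Σ aᵢ gᵢ‖²` for all `t K r` and Gaussian `gᵢ`. -/
theorem sharp_of_normalOrder (hN : NormalOrder) :
    ∀ (t K r : ℕ) (a : Fin r → ℂ) (g : Fin r → QReg (t * 4) → ℂ), (∀ i, IsGaussian (g i)) →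
      ((t.choose K * 8 ^ K : ℕ) : ℝ) - ((r * flatteningDeficiency K (t * 4) : ℕ) : ℝ)
        ≤ ((t.choose K * 8 ^ K : ℕ) : ℝ) * normSq (magicMPow t - ∑ i, a i • g i) := by
  classical
  intro t K r a g hg
  -- the flat family: labels, monomials, index type (verbatim from the 1245 composition)
  let lab : (Fin t → Option (Fin 4 × Bool)) → List (Fin (t * 4) × Bool) := fun s =>
    (List.finRange t).filterMap fun b => (s b).map fun q => (finProdFinEquiv (b, q.1), q.2)
  let mono : (Fin t → Option (Fin 4 × Bool)) → Matrix (QReg (t * 4)) (QReg (t * 4)) ℂ := fun s =>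
    ((List.finRange t).filterMap fun b =>
      (s b).map fun q => majorana (t * 4) (finProdFinEquiv (b, q.1)) q.2).prod
  have hmono_lab : ∀ s, mono s = ((lab s).map fun p => majorana (t * 4) p.1 p.2).prod := by
    intro s
    simp only [mono, lab, List.map_filterMap, Option.map_map]
    rfl
  let ι : Type := {s : Fin t → Option (Fin 4 × Bool) // (univ.filter fun b => (s b).isSome).card = K}
  -- deficiency subspace
  obtain ⟨W, hW, hmem⟩ := deficiency_of_normalOrder hN (t * 4) K r a g hg
  -- unitarity of the monomials
  have hunit : ∀ s, mono s ∈ Matrix.unitaryGroup (QReg (t * 4)) ℂ := by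
    intro s
    rw [hmono_lab]
    refine list_prod_mem ?_
    intro x hx
    obtain ⟨p, -, rfl⟩ := List.mem_map.1 hx
    exact majorana_mem_unitaryGroup _ _ _
  -- orthonormality of the images of M^{⊗t} (landed)
  obtain ⟨hO1, hO2⟩ := flatOrthonormal_landed t mono (fun s => rfl)
  -- the mass bound (landed stub_massBound)
  have hmass := stub_massBound (t * 4) ι (fun s => mono s.1) (magicMPow t) (∑ i, a i • g i) W
    (fun s => hunit s.1) (fun s => hO1 s.1)
    (fun s s' hss' => hO2 s.1 s'.1 fun h => hss' (Subtype.ext h))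
    (fun s => by
      show mono s.1 *ᵥ _ ∈ W
      rw [hmono_lab]
      exact hmem (lab s.1) ((length_filterMap_labels t s.1).trans s.2))
  -- counting: only the LOWER count of the flat family is needed
  have hR : t.choose K * 8 ^ K ≤ Fintype.card ι := countGap_choose_mul_pow_le_card t K
  have hRr : ((t.choose K * 8 ^ K : ℕ) : ℝ) ≤ (Fintype.card ι : ℝ) := by exact_mod_cast hR
  have hWle : (Module.finrank ℂ W : ℝ) ≤ ((r * flatteningDeficiency K (t * 4) : ℕ) : ℝ) := by
    exact_mod_cast hW
  have hx0 : 0 ≤ normSq (magicMPow t - ∑ i, a i • g i) := normSq_nonneg' _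
  by_cases hx1 : normSq (magicMPow t - ∑ i, a i • g i) ≤ 1
  · have hbr : ((t.choose K * 8 ^ K : ℕ) : ℝ) * (1 - normSq (magicMPow t - ∑ i, a i • g i)) ≤
        (Fintype.card ι : ℝ) * (1 - normSq (magicMPow t - ∑ i, a i • g i)) :=
      mul_le_mul_of_nonneg_right hRr (by linarith)
    linarith [hmass, hWle, hbr]
  · push Not at hx1
    have hRnn : (0 : ℝ) ≤ ((t.choose K * 8 ^ K : ℕ) : ℝ) := by positivity
    have hDnn : (0 : ℝ) ≤ ((r * flatteningDeficiency K (t * 4) : ℕ) : ℝ) := by positivity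
    nlinarith [hRnn, hDnn, hx1]

/-- **Crux 1246 from the single open stub of the 1245 line.** -/
theorem flatteningBoundRobust_of_normalOrder (hN : NormalOrder) : FlatteningBoundRobust := by
  unfold FlatteningBoundRobust
  intro maj IsGauss Mpow t K r hlt a g hg
  have hg' : ∀ i, IsGaussian (g i) := hg
  have h1 := sharp_of_normalOrder hN t K r a g hg'
  show (1 : ℝ) ≤ (((t * 8).choose K : ℕ) : ℝ) * normSq (magicMPow t - ∑ i, a i • g i)
  have hlt' : r * flatteningDeficiency K (t * 4) + 1 ≤ t.choose K * 8 ^ K := hlt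
  have hRC : t.choose K * 8 ^ K ≤ (t * 8).choose K := choose_mul_pow_le t K
  have hnn : 0 ≤ normSq (magicMPow t - ∑ i, a i • g i) := normSq_nonneg' _
  have e1 : (1 : ℝ) ≤ ((t.choose K * 8 ^ K : ℕ) : ℝ) - ((r * flatteningDeficiency K (t * 4) : ℕ) : ℝ) := by
    have hc : (((r * flatteningDeficiency K (t * 4) + 1 : ℕ)) : ℝ) ≤ ((t.choose K * 8 ^ K : ℕ) : ℝ) := by
      exact_mod_cast hlt'
    push_cast at hc ⊢
    linarith
  have e2 : ((t.choose K * 8 ^ K : ℕ) : ℝ) ≤ (((t * 8).choose K : ℕ) : ℝ) := by exact_mod_cast hRC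
  calc (1 : ℝ) ≤ ((t.choose K * 8 ^ K : ℕ) : ℝ) - ((r * flatteningDeficiency K (t * 4) : ℕ) : ℝ) := e1
    _ ≤ ((t.choose K * 8 ^ K : ℕ) : ℝ) * normSq (magicMPow t - ∑ i, a i • g i) := h1
    _ ≤ (((t * 8).choose K : ℕ) : ℝ) * normSq (magicMPow t - ∑ i, a i • g i) :=
        mul_le_mul_of_nonneg_right e2 hnn

/-- The same for the support item `FlatteningBoundExact` (stmt-QuantumAdvantage-1249). -/
theorem flatteningBoundExact_of_normalOrder (hN : NormalOrder) :
    Summit.QuantumAdvantage.QuantumAdvantage.Theses.SpinorFlattening.FlatteningBoundExact := by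
  have hR := flatteningBoundRobust_of_normalOrder hN
  unfold FlatteningBoundRobust at hR
  unfold Summit.QuantumAdvantage.QuantumAdvantage.Theses.SpinorFlattening.FlatteningBoundExact
  intro maj IsGauss Mpow t K r hlt a g hg heq
  have h1 := hR t K r hlt a g hg
  have hzero : normSq (magicMPow t - ∑ i, a i • g i) = 0 := by
    have : magicMPow t - ∑ i, a i • g i = 0 := sub_eq_zero.2 heq
    rw [this]
    simp [normSq]
  have h1' : (1 : ℝ) ≤ (((t * 8).choose K : ℕ) : ℝ) * normSq (magicMPow t - ∑ i, a i • g i) := h1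
  rw [hzero, mul_zero] at h1'
  exact absurd h1' (by norm_num)

end Summit.QuantumAdvantage.QuantumAdvantage.Cruxes.FlatteningBoundRobust.Triage2Corollary

end
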